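import Literature.NumberTheory.EllipticCurves.HeegnerPointsKolyvaginEulerSystem
import Mathlib.Tactic.Ring
import Mathlib.Tactic.Module
import HarnessLib

/-!
# The COUPLED Kolyvagin descent at level one — THEOREM K2's deduction, kernel-checked

Helper toward crux `UpperOffV0HSYPlus` (stmt-BirchSwinnertonDyer-19804) of route
`SylvesterTwoHeegnerIndex` (rung K7t, leaf `X12.CMAtTwo`), skeleton of record VARIANT K
`Cruxes/UpperOffV0HSYPlus/Lines/coupled_variantK.lean`, stub `stub_firstLayerFour` = «THEOREM K2
typed» (cell memo MEMO-bsd-cm-two §57.4, refereed desks (M) g59 / (M-h3) g60): for the Hu–Shu–Yin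
pair `(B, A) = (E_p, E_{3p²})` over the CM field `K = ℚ(ω)` at the inert prime `2`, if HSY's point
`Y ∈ B(K)` is `2`-primitive then `Sel₂(A_K/K) = 0` and `Sel₂(B_K/K) = 𝔽₄·δY`.

This file is the `p = 2` COUPLED counterpart of the tree's (odd-`p`, one-curve, `τ`-eigenspace)
`Literature/NumberTheory/EllipticCurves/HeegnerPointsKolyvaginSelmerProofs.lean`
(`KolyvaginDescent.Hypotheses.claim_10_1`, `.c_eq_zero`, `.claim_10_3`,
`selmerGroup_eq_zmultiples_of_leaves`), whose abstract data `KolyvaginDescent.Hypotheses` carry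
the fields `hp2 : p ≠ 2`, the involution `τ`, the sign `ε` and `τ`-eigen hypotheses in `prop82` and
`cebotarev` — none of which survives at `p = 2`. Memo two §57 replaces them as follows (the
«dictionary»): Gross's `ε`-eigenspace ↦ the curve `B = E_p` (carrier of the non-torsion bottom
class `δY`); the `−ε`-eigenspace ↦ the cubic-twist partner `A = E_{3p²}`; Prop. 6.2 (2) ↦ the FLIP
LEMMA («at an inert Kolyvagin prime the Frobenius conjugates the CM action, so the singular part
of the `χ`-class is governed by the `χ̄`-point one level down»): `d_A(ℓ)_λ = 0 ⟺ Y ∈ 2B(K_λ)` and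
`d_B(ℓℓ′)_λ = 0 ⟺ P_{ℓ′}^{χ_A} ∈ 2E(K_λ) ⟺ c_A(ℓ′)_λ = 0`; Prop. 8.2 ↦ duality WITHOUT eigen-signs
(Lemma K1: the local groups at a Kolyvagin prime are free of rank one over `𝒪/2 = 𝔽₄`, so the
`𝒪`-orbit of one non-zero singular class fills the local group; Step 6); McCallum's Cor. 3.2 for
`τ`-eigenclasses ↦ two Čebotarev REALIZABILITY clauses (Steps 2–5: `Gal(L_{X,S}/L_X) ≅
Hom_{𝔽₄}(S, X[2])`, `(1+τ)H = H^τ` by surjectivity of `Tr_{𝔽₄/𝔽₂}`, `[s, φ ⊗ e] = 0 ⟺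
φ(s₀) = φ(s₁) = 0`, and the linear disjointness of `L_{A,S}/L_A` and `L_{B,S′}/L_B` over `K`).

## Contents

* §A ABSTRACT COUPLED DESCENT (pure logic in two abelian groups; `variable`s, no structure):
  `selA_eq_bot` (K2-A = Claim 10.1), `cA_eq_zero_of_mem` (Prop. 10.2), `exists_eq_add_of_mem_selB`
  and `selB_le_closure` (K2-B = Claim 10.3: `Sel_B ⊆ {a•y + b•w y}`).
* §B INSTANTIATION ON THE TREE'S OBJECTS: `V_X = galH1Torsion (X.baseChange K) p`,
  `Sel_X = selmerGroup`, local conditions `selmerLocalKer` at the places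
  `HeightOneSpectrum (𝓞 K) ⊕ InfinitePlace K`, strict conditions `torsionLocalKer`,
  `y = kummerClassOfPoint B K hp Y`; for ANY prime `p`, number field `K`, predicate `Kol` of
  rational primes inert in `K`, pair `(A, B)` of Weierstrass curves over `ℚ`, point `Y ∈ B(K)` with
  `p ∤ Y`, and additive operator `w` on `H¹(K, B_K[p])`, FROM THREE LEAF-SHAPED HYPOTHESES
  (binders — nothing is asserted, no `Prop` is defined): (L1) coupled classes `cA (ℓ)`, `cB (ℓ*ℓ′)`
  Kummer off their level with the two FLIP criteria; (L2) duality at the Kolyvagin primes for `A`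
  and for `B`; (L3) the two Čebotarev clauses. These are the `p = 2` counterparts of the tree's
  named facts `Gross1991_kolyvaginClasses` / `Gross1991_prop_8_2` / `McCallum1991_cor_3_2_eigen`
  and are what a kernel port of ROAD (k) must deliver for the HSY frame. CURRENCY of (L1): the
  classes are meant to be the tree's `KolyvaginCocycle.kolyvaginClass (X.baseChange K) n …`
  (`HeegnerPointsKolyvaginPrimaryClassesProofs`) of the `χ`-isotypic derived CM points transported
  along k-ty1 g2's cubic twist (p618619 `CubicTwistTransportJZero`: `JZero.exists_cubicTwist_transport`,
  `cubicTwist_mem_invPoints_iff`, `kolyvaginClass_cubicTwist_eq_zero_iff`,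
  `torsionH1ToH1_kolyvaginClass_cubicTwist_eq_zero_iff`), whose local API
  (`kolyvaginClass_mem_selmerLocalKer_of_forall_smul_eq` off the level; the FLIP LEMMA at the
  level) is exactly the membership data (L1) asks for; (L1) is kept abstract over
  `galH1Torsion`/`selmerLocalKer`/`torsionLocalKer` so that any such construction feeds it.
  Selmer objects are the tree's `selmerGroup (X.baseChange K) (p : ℤ)`; at `p = 2 = 2^1` these are
  the groups of k-ty1's order/structure forms (p617120 `natCard_selmerGroup_baseChange_eq_sq`,
  stated at `((2^M : ℕ) : ℤ)`; instantiate `M = 1` and rewrite `pow_one`).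
  Main theorem: `selmerGroup_eq_bot_and_le_closure_of_coupledLeaves` — THEOREM K2 in Selmer form,
  `Sel_p(A_K/K) = ⊥ ∧ Sel_p(B_K/K) ≤ closure {δY, w(δY)}`.

Honest scope. Nothing here is specific to `p = 2` or to CM: the deduction holds for any data with
(L1)–(L3); the arithmetic behind the leaves (HSY's conductor-`9pn` CM points for (L1); Lemma K1 +
Tate duality + reciprocity for (L2); Steps 2–5 for (L3); `w = [ω]`, `Kol ℓ ⟺ ℓ ≡ 5 (6), ℓ ∤ 3p`)
is the open kernel programme of rows k-p1/k-p2 and is NOT claimed. No item closed, no label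
moves, BSD not claimed. Sources: Gross 1991 (LMS LN 153) §10; McCallum 1991 (ibid.) §§3, 5;
MEMO-bsd-cm-two §57.0–§57.4; line card `Cruxes/UpperOffV0HSYPlus/Lines/cmframe-kolyvagin2.md` v13.
-/

-- every Summits module is named `Summit.<Summit>.<Problem>…`: the duplicated component is by design
set_option linter.dupNamespace false

noncomputable section

open scoped Classical
open WeierstrassCurve NumberField IsDedekindDomain

universe u

namespace Summit.BirchSwinnertonDyer.BirchSwinnertonDyer.Theorems.SylvesterTwoCoupledDescentAtTwo

open Literature.NumberTheory.EllipticCurves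

/-! ## §A. The abstract coupled descent (memo two §57.4, Steps 7–8) -/

section Abstract

variable {VA VB : Type*} [AddCommGroup VA] [AddCommGroup VB] {Pl : Type*}
  -- the Selmer groups `Sel_A ≤ V_A = H¹(K, A[p])`, `Sel_B ≤ V_B = H¹(K, B[p])`
  {SelA : AddSubgroup VA} {SelB : AddSubgroup VB}
  -- the Selmer local conditions `d_v = 0 in H¹(K_v, X)` at the places `v : Pl`
  {LocA : Pl → AddSubgroup VA} {LocB : Pl → AddSubgroup VB}
  -- Kolyvagin primes and the place `λ = ℓ𝒪_K` above each
  {Kol : ℕ → Prop} {pl : ℕ → Pl}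
  -- the strict local conditions `s_λ = 0 in H¹(K_λ, X[p])`
  {AA : ℕ → AddSubgroup VA} {AB : ℕ → AddSubgroup VB}
  -- the bottom class `y = δY ∈ Sel_B`, the CM operator `w = [ω]` on `V_B`, the coupled classes
  {y : VB} {w : VB →+ VB} {cA : ℕ → VA} {cB : ℕ → VB}

variable
  (mem_selA_iff : ∀ s, s ∈ SelA ↔ ∀ v, s ∈ LocA v)
  (y_ne : y ≠ 0)
  /- (L1) the coupled classes: Kummer away from their level (Gross Prop. 6.2 (1)) and the two FLIP
  criteria (memo two §57.3, in place of Prop. 6.2 (2)) -/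
  (cA_mem_loc : ∀ ℓ, Kol ℓ → ∀ v, v ≠ pl ℓ → cA ℓ ∈ LocA v)
  (cA_mem_loc_iff : ∀ ℓ, Kol ℓ → (cA ℓ ∈ LocA (pl ℓ) ↔ y ∈ AB ℓ))
  (cB_mem_loc : ∀ ℓ ℓ', Kol ℓ → Kol ℓ' → ℓ ≠ ℓ' → ∀ v, v ≠ pl ℓ → v ≠ pl ℓ' →
    cB (ℓ * ℓ') ∈ LocB v)
  (cB_mem_loc_iff : ∀ ℓ ℓ', Kol ℓ → Kol ℓ' → ℓ ≠ ℓ' →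
    (cB (ℓ * ℓ') ∈ LocB (pl ℓ) ↔ cA ℓ' ∈ AA ℓ))
  /- (L2) duality at a Kolyvagin prime, no eigen-signs (memo Step 6 / Lemma K1) -/
  (dualA : ∀ ℓ, Kol ℓ → ∀ d : VA, (∀ v, v ≠ pl ℓ → d ∈ LocA v) → d ∉ LocA (pl ℓ) →
    ∀ s ∈ SelA, s ∈ AA ℓ)
  (dualB : ∀ ℓ, Kol ℓ → ∀ d : VB, (∀ v, v ≠ pl ℓ → d ∈ LocB v) → d ∉ LocB (pl ℓ) →
    ∀ s ∈ SelB, s ∈ AB ℓ)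
  /- (L3) Čebotarev realizability (memo Steps 2–5 + disjointness), two clauses -/
  (ceb_ne : ∀ (s : VA) (t : VB) (b : ℕ), ∃ ℓ, b < ℓ ∧ Kol ℓ ∧ (s ≠ 0 → s ∉ AA ℓ) ∧
    (t ≠ 0 → t ∉ AB ℓ))
  (ceb_line : ∀ s ∈ SelB, (¬ ∃ a b : ℤ, s = a • y + b • w y) → ∀ c : VA, c ≠ 0 →
    ∀ b : ℕ, ∃ ℓ, b < ℓ ∧ Kol ℓ ∧ y ∈ AB ℓ ∧ s ∉ AB ℓ ∧ c ∉ AA ℓ)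

include y_ne cA_mem_loc cA_mem_loc_iff dualA ceb_ne in
/-- **K2-A (memo two §57.4 Step 7 = Gross 1991 Claim 10.1 for the partner curve): `Sel_A = 0`.**
Given `s ∈ Sel_A`, `s ≠ 0`, Čebotarev (clause `ceb_ne`) gives a Kolyvagin prime `ℓ` with `s_λ ≠ 0`
and `(δY)_λ ≠ 0`; by the level-one FLIP the class `d_A(ℓ)` is then singular at `λ` and Kummer
elsewhere, so duality forces `s_λ = 0` — contradiction. Abstract: any data with (L1)–(L3). -/
theorem selA_eq_bot : SelA = ⊥ := by
  refine (AddSubgroup.eq_bot_iff_forall _).mpr fun s hs ↦ ?_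
  by_contra hs0
  obtain ⟨ℓ, -, hℓ, hsℓ, hyℓ⟩ := ceb_ne s y 0
  have h1 : cA ℓ ∉ LocA (pl ℓ) := fun h ↦ hyℓ y_ne ((cA_mem_loc_iff ℓ hℓ).mp h)
  exact hsℓ hs0 (dualA ℓ hℓ (cA ℓ) (fun v hv ↦ cA_mem_loc ℓ hℓ v hv) h1 s hs)

include y_ne mem_selA_iff cA_mem_loc cA_mem_loc_iff dualA ceb_ne in
/-- **Coupled Prop. 10.2, (6) ⟹ (1) (memo two §57.4 Step 8 (c); Gross 1991 Prop. 10.2): if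
`(δY)_λ = 0` then `c_A(ℓ) = 0`.** By the level-one FLIP the class `c_A(ℓ)` is then Kummer at `λ`
too, hence lies in `Sel_A`, which vanishes by K2-A. -/
theorem cA_eq_zero_of_mem {ℓ : ℕ} (hℓ : Kol ℓ) (hy : y ∈ AB ℓ) : cA ℓ = 0 := by
  have hsel : cA ℓ ∈ SelA := (mem_selA_iff _).mpr fun v ↦ by
    by_cases hv : v = pl ℓ
    · rw [hv]
      exact (cA_mem_loc_iff ℓ hℓ).mpr hy
    · exact cA_mem_loc ℓ hℓ v hv
  have hbot := selA_eq_bot (SelA := SelA) y_ne cA_mem_loc cA_mem_loc_iff dualA ceb_ne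
  rw [hbot] at hsel
  exact (AddSubgroup.mem_bot).mp hsel

include y_ne mem_selA_iff cA_mem_loc cA_mem_loc_iff cB_mem_loc cB_mem_loc_iff dualA dualB ceb_ne
  ceb_line in
/-- **K2-B (memo two §57.4 Step 8 = Gross 1991 Claim 10.3 for the coupled pair): every Selmer
class of `B` lies on the `𝒪`-line of `δY`, `Sel_B ⊆ {a•y + b•w y}`.** If `s ∈ Sel_B` is off the
line: (a) Čebotarev gives `ℓ′` with `(δY)_{λ′} ≠ 0`, so by the FLIP `c_A(ℓ′)` is singular at `λ′`,
in particular `c_A(ℓ′) ≠ 0`; (b) Čebotarev (clause `ceb_line`) gives `ℓ > ℓ′` with `(δY)_λ = 0`,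
`s_λ ≠ 0`, `c_A(ℓ′)_λ ≠ 0`; (c) then `c_A(ℓ) = 0` (coupled Prop. 10.2), so by the level-two FLIP
`d_B(ℓℓ′)` is Kummer at `λ′` and singular at `λ`, Kummer elsewhere; (d) duality forces `s_λ = 0` —
contradiction. -/
theorem exists_eq_add_of_mem_selB {s : VB} (hs : s ∈ SelB) :
    ∃ a b : ℤ, s = a • y + b • w y := by
  by_contra hns
  -- (a) an auxiliary Kolyvagin prime `ℓ'` with `(δY)_{λ'} ≠ 0`, hence `c_A(ℓ') ≠ 0`
  obtain ⟨ℓ', -, hℓ', -, hyℓ'⟩ := ceb_ne 0 y 0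
  have hc'loc : cA ℓ' ∉ LocA (pl ℓ') := fun h ↦ hyℓ' y_ne ((cA_mem_loc_iff ℓ' hℓ').mp h)
  have hc'0 : cA ℓ' ≠ 0 := fun h ↦ hc'loc (h ▸ zero_mem _)
  -- (b) the prime `ℓ > ℓ'` with `(δY)_λ = 0`, `s_λ ≠ 0`, `c_A(ℓ')_λ ≠ 0`
  obtain ⟨ℓ, hlt, hℓ, hyℓ, hsℓ, hcℓ⟩ := ceb_line s hs hns (cA ℓ') hc'0 ℓ'
  have hne : ℓ ≠ ℓ' := Nat.ne_of_gt hlt -- (c) `c_A(ℓ) = 0`: `d_B(ℓℓ')` Kummer at `λ'`, not `λ`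
  have hcℓ0 : cA ℓ = 0 :=
    cA_eq_zero_of_mem (SelA := SelA) mem_selA_iff y_ne cA_mem_loc cA_mem_loc_iff dualA ceb_ne hℓ hyℓ
  have hat' : cB (ℓ * ℓ') ∈ LocB (pl ℓ') := by
    rw [Nat.mul_comm]
    exact (cB_mem_loc_iff ℓ' ℓ hℓ' hℓ hne.symm).mpr (hcℓ0 ▸ zero_mem _)
  have hat : cB (ℓ * ℓ') ∉ LocB (pl ℓ) := fun h ↦ hcℓ ((cB_mem_loc_iff ℓ ℓ' hℓ hℓ' hne).mp h)
  have hoff : ∀ v, v ≠ pl ℓ → cB (ℓ * ℓ') ∈ LocB v := fun v hv ↦ by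
    by_cases hv' : v = pl ℓ'
    · rw [hv']
      exact hat'
    · exact cB_mem_loc ℓ ℓ' hℓ hℓ' hne v hv hv'
  exact hsℓ (dualB ℓ hℓ (cB (ℓ * ℓ')) hoff hat s hs) -- (d) duality

include y_ne mem_selA_iff cA_mem_loc cA_mem_loc_iff cB_mem_loc cB_mem_loc_iff dualA dualB ceb_ne
  ceb_line in
/-- **K2-B, subgroup form: `Sel_B ≤ closure {y, w y}`** (the `𝒪`-line `𝒪·δY = {0, y, ωy, ω²y}`
when `p = 2`, `w = [ω]`). -/
theorem selB_le_closure : SelB ≤ AddSubgroup.closure {y, w y} := by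
  intro s hs
  obtain ⟨a, b, rfl⟩ := exists_eq_add_of_mem_selB (SelA := SelA) (SelB := SelB) mem_selA_iff y_ne
    cA_mem_loc cA_mem_loc_iff cB_mem_loc cB_mem_loc_iff dualA dualB ceb_ne ceb_line hs
  exact add_mem (AddSubgroup.zsmul_mem _ (AddSubgroup.subset_closure (by simp)) a)
    (AddSubgroup.zsmul_mem _ (AddSubgroup.subset_closure (by simp)) b)

end Abstract

/-! ## §B. Instantiation on the tree's `H¹(K, X[p])`, Selmer groups and local kernels -/

section Instantiation

variable {K : Type u} [Field K] [NumberField K] (A B : WeierstrassCurve ℚ)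

/-- **THEOREM K2 (Selmer form) from the three coupled leaves, on the tree's objects.** For a prime
`p`, a number field `K`, a predicate `Kol` of rational primes `ℓ` INERT in `K` (`ℓ𝒪_K` prime —
for `K = ℚ(ω)`: `ℓ ≡ 2 (3)`), two Weierstrass curves `A, B` over `ℚ` (the pair
`(E_{3p²}, E_p)` of memo two §57), a point `Y ∈ B(K)` not divisible by `p` in `B(K)` (so that
`δY ≠ 0`, tree `kummerClassOfPoint_ne_zero`) and an additive operator `w` on `H¹(K, B_K[p])`
(the CM operator `[ω]` of `JZero.exists_cm_operator_galH1Torsion`), ASSUME: (L1) coupled classes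
`cA ℓ ∈ H¹(K, A_K[p])`, `cB (ℓ*ℓ′) ∈ H¹(K, B_K[p])` at Kolyvagin primes, satisfying the Selmer
local condition (`selmerLocalKer`) at every finite place not dividing their level and at every
infinite place, with the FLIP criteria at the places dividing the level — `cA ℓ` is Kummer at
`λ ∋ ℓ` iff `(δY)_λ = 0` (`torsionLocalKer`), and `cB (ℓ*ℓ′)` is Kummer at `λ ∋ ℓ` iff
`(cA ℓ′)_λ = 0`; (L2) duality at Kolyvagin primes for `A` and for `B`: a class Kummer off `λ` and
singular at `λ` forces `s_λ = 0` for every Selmer class `s`; (L3) Čebotarev: (a) for any classes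
`s`, `t` there are infinitely many Kolyvagin `ℓ` at which the non-zero ones among `s_λ`, `t_λ` are
non-zero, (b) for `s ∈ Sel_p(B_K/K)` off the line `{a•δY + b•w δY}` and `c ≠ 0` in `H¹(K, A_K[p])`
there are infinitely many Kolyvagin `ℓ` with `(δY)_λ = 0`, `s_λ ≠ 0`, `c_λ ≠ 0`. THEN
`Sel_p(A_K/K) = 0` and `Sel_p(B_K/K) ≤ closure {δY, w δY}` (for `p = 2`, `w = [ω]`: the `𝒪`-line
`𝔽₄·δY`). Proof: §A for `V_X = galH1Torsion (X.baseChange K) p`, the local conditions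
`selmerLocalKer` at `HeightOneSpectrum (𝓞 K) ⊕ InfinitePlace K` (`mem_selmerGroup_iff`), the strict
conditions `⨅_{v ∋ ℓ} torsionLocalKer`, `λ = ℓ𝒪_K` the unique place above `ℓ`, exactly as the
tree's `exists_hypotheses_of_leaves` instantiates Gross's §10. Memo two §57.4 THEOREM K2; the
leaves are NOT proved here. -/
theorem selmerGroup_eq_bot_and_le_closure_of_coupledLeaves {p : ℕ} (hp : p.Prime)
    (Kol : ℕ → Prop) (hKol : ∀ ℓ, Kol ℓ → ℓ.Prime ∧ (Ideal.span {(ℓ : 𝓞 K)}).IsPrime)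
    {Y : (B.baseChange K).toAffine.Point}
    (hY : ¬ ∃ Q : (B.baseChange K).toAffine.Point, p • Q = Y)
    (w : galH1Torsion (B.baseChange K) p →+ galH1Torsion (B.baseChange K) p)
    (hL1 : ∃ (cA : ℕ → galH1Torsion (A.baseChange K) p)
        (cB : ℕ → galH1Torsion (B.baseChange K) p),
      (∀ ℓ, Kol ℓ →
        (∀ v : HeightOneSpectrum (𝓞 K), (ℓ : 𝓞 K) ∉ v.asIdeal →
          cA ℓ ∈ selmerLocalKer (A.baseChange K) (v.adicCompletion K) p) ∧
        (∀ x : InfinitePlace K, cA ℓ ∈ selmerLocalKer (A.baseChange K) x.Completion p) ∧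
        (∀ v : HeightOneSpectrum (𝓞 K), (ℓ : 𝓞 K) ∈ v.asIdeal →
          (cA ℓ ∈ selmerLocalKer (A.baseChange K) (v.adicCompletion K) p ↔
            kummerClassOfPoint B K hp Y ∈
              (B.baseChange K).torsionLocalKer (v.adicCompletion K) p))) ∧
      (∀ ℓ ℓ', Kol ℓ → Kol ℓ' → ℓ ≠ ℓ' →
        (∀ v : HeightOneSpectrum (𝓞 K), (ℓ : 𝓞 K) ∉ v.asIdeal → (ℓ' : 𝓞 K) ∉ v.asIdeal →
          cB (ℓ * ℓ') ∈ selmerLocalKer (B.baseChange K) (v.adicCompletion K) p) ∧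
        (∀ x : InfinitePlace K, cB (ℓ * ℓ') ∈ selmerLocalKer (B.baseChange K) x.Completion p) ∧
        (∀ v : HeightOneSpectrum (𝓞 K), (ℓ : 𝓞 K) ∈ v.asIdeal →
          (cB (ℓ * ℓ') ∈ selmerLocalKer (B.baseChange K) (v.adicCompletion K) p ↔
            cA ℓ' ∈ (A.baseChange K).torsionLocalKer (v.adicCompletion K) p))))
    (hL2A : ∀ ℓ, Kol ℓ → ∀ d : galH1Torsion (A.baseChange K) p,
      (∀ v : HeightOneSpectrum (𝓞 K), (ℓ : 𝓞 K) ∉ v.asIdeal →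
        d ∈ selmerLocalKer (A.baseChange K) (v.adicCompletion K) p) →
      (∀ x : InfinitePlace K, d ∈ selmerLocalKer (A.baseChange K) x.Completion p) →
      ∀ v : HeightOneSpectrum (𝓞 K), (ℓ : 𝓞 K) ∈ v.asIdeal →
        d ∉ selmerLocalKer (A.baseChange K) (v.adicCompletion K) p →
        ∀ s ∈ selmerGroup (A.baseChange K) p,
          s ∈ (A.baseChange K).torsionLocalKer (v.adicCompletion K) p)
    (hL2B : ∀ ℓ, Kol ℓ → ∀ d : galH1Torsion (B.baseChange K) p,
      (∀ v : HeightOneSpectrum (𝓞 K), (ℓ : 𝓞 K) ∉ v.asIdeal →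
        d ∈ selmerLocalKer (B.baseChange K) (v.adicCompletion K) p) →
      (∀ x : InfinitePlace K, d ∈ selmerLocalKer (B.baseChange K) x.Completion p) →
      ∀ v : HeightOneSpectrum (𝓞 K), (ℓ : 𝓞 K) ∈ v.asIdeal →
        d ∉ selmerLocalKer (B.baseChange K) (v.adicCompletion K) p →
        ∀ s ∈ selmerGroup (B.baseChange K) p,
          s ∈ (B.baseChange K).torsionLocalKer (v.adicCompletion K) p)
    (hL3a : ∀ (s : galH1Torsion (A.baseChange K) p) (t : galH1Torsion (B.baseChange K) p),
      Set.Infinite {ℓ : ℕ | Kol ℓ ∧ ∀ v : HeightOneSpectrum (𝓞 K), (ℓ : 𝓞 K) ∈ v.asIdeal →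
        (s ≠ 0 → s ∉ (A.baseChange K).torsionLocalKer (v.adicCompletion K) p) ∧
        (t ≠ 0 → t ∉ (B.baseChange K).torsionLocalKer (v.adicCompletion K) p)})
    (hL3b : ∀ s ∈ selmerGroup (B.baseChange K) p,
      (¬ ∃ a b : ℤ, s = a • kummerClassOfPoint B K hp Y + b • w (kummerClassOfPoint B K hp Y)) →
      ∀ c : galH1Torsion (A.baseChange K) p, c ≠ 0 →
      Set.Infinite {ℓ : ℕ | Kol ℓ ∧ ∀ v : HeightOneSpectrum (𝓞 K), (ℓ : 𝓞 K) ∈ v.asIdeal →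
        kummerClassOfPoint B K hp Y ∈ (B.baseChange K).torsionLocalKer (v.adicCompletion K) p ∧
        s ∉ (B.baseChange K).torsionLocalKer (v.adicCompletion K) p ∧
        c ∉ (A.baseChange K).torsionLocalKer (v.adicCompletion K) p}) :
    selmerGroup (A.baseChange K) p = ⊥ ∧
      selmerGroup (B.baseChange K) p ≤
        AddSubgroup.closure {kummerClassOfPoint B K hp Y, w (kummerClassOfPoint B K hp Y)} := by
  obtain ⟨cA, cB, hcA, hcB⟩ := hL1 -- then: the place `λ = ℓ𝒪_K` above `ℓ`, and its uniqueness
  let place : ∀ ℓ, Kol ℓ → HeightOneSpectrum (𝓞 K) := fun ℓ h ↦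
    ⟨Ideal.span {(ℓ : 𝓞 K)}, (hKol ℓ h).2, by
      rw [Ne, Ideal.span_singleton_eq_bot]
      exact_mod_cast (hKol ℓ h).1.ne_zero⟩
  have mem_place : ∀ ℓ (h : Kol ℓ), (ℓ : 𝓞 K) ∈ (place ℓ h).asIdeal := fun ℓ h ↦
    Ideal.mem_span_singleton_self _
  have mem_iff : ∀ ℓ (h : Kol ℓ) (v : HeightOneSpectrum (𝓞 K)),
      (ℓ : 𝓞 K) ∈ v.asIdeal ↔ v = place ℓ h := by
    intro ℓ h v
    refine ⟨fun hv ↦ ?_, fun hv ↦ hv ▸ mem_place ℓ h⟩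
    apply HeightOneSpectrum.ext
    have hle : (place ℓ h).asIdeal ≤ v.asIdeal := (Ideal.span_singleton_le_iff_mem _).mpr hv
    exact ((Ideal.IsPrime.isMaximal (place ℓ h).isPrime (place ℓ h).ne_bot).eq_of_le
      v.isPrime.ne_top hle).symm
  -- the abstract data: places, local conditions, `λ`, strict conditions
  let Pl := HeightOneSpectrum (𝓞 K) ⊕ InfinitePlace K
  let LocA : Pl → AddSubgroup (galH1Torsion (A.baseChange K) p) :=
    Sum.elim (fun v ↦ selmerLocalKer (A.baseChange K) (v.adicCompletion K) p)
      (fun x ↦ selmerLocalKer (A.baseChange K) x.Completion p)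
  let LocB : Pl → AddSubgroup (galH1Torsion (B.baseChange K) p) :=
    Sum.elim (fun v ↦ selmerLocalKer (B.baseChange K) (v.adicCompletion K) p)
      (fun x ↦ selmerLocalKer (B.baseChange K) x.Completion p)
  let pl : ℕ → Pl := fun ℓ ↦
    if h : Kol ℓ then Sum.inl (place ℓ h) else Sum.inr (Classical.arbitrary _)
  let AA : ℕ → AddSubgroup (galH1Torsion (A.baseChange K) p) := fun ℓ ↦
    ⨅ (v : HeightOneSpectrum (𝓞 K)) (_ : (ℓ : 𝓞 K) ∈ v.asIdeal),
      (A.baseChange K).torsionLocalKer (v.adicCompletion K) p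
  let AB : ℕ → AddSubgroup (galH1Torsion (B.baseChange K) p) := fun ℓ ↦
    ⨅ (v : HeightOneSpectrum (𝓞 K)) (_ : (ℓ : 𝓞 K) ∈ v.asIdeal),
      (B.baseChange K).torsionLocalKer (v.adicCompletion K) p
  have pl_eq : ∀ ℓ (h : Kol ℓ), pl ℓ = Sum.inl (place ℓ h) := fun ℓ h ↦ dif_pos h
  -- membership in the strict condition `AX ℓ` is membership at the one place `λ`
  have memAA : ∀ ℓ (h : Kol ℓ) (s : galH1Torsion (A.baseChange K) p), s ∈ AA ℓ ↔
      s ∈ (A.baseChange K).torsionLocalKer ((place ℓ h).adicCompletion K) p := by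
    intro ℓ h s
    simp only [AA, AddSubgroup.mem_iInf]
    exact ⟨fun H ↦ H _ (mem_place ℓ h), fun H v hv ↦ by rwa [(mem_iff ℓ h v).mp hv]⟩
  have memAB : ∀ ℓ (h : Kol ℓ) (s : galH1Torsion (B.baseChange K) p), s ∈ AB ℓ ↔
      s ∈ (B.baseChange K).torsionLocalKer ((place ℓ h).adicCompletion K) p := by
    intro ℓ h s
    simp only [AB, AddSubgroup.mem_iInf]
    exact ⟨fun H ↦ H _ (mem_place ℓ h), fun H v hv ↦ by rwa [(mem_iff ℓ h v).mp hv]⟩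
  -- a finite place other than `λ` does not contain `ℓ`
  have not_mem_of_ne : ∀ ℓ (h : Kol ℓ) (v : HeightOneSpectrum (𝓞 K)),
      (Sum.inl v : Pl) ≠ pl ℓ → (ℓ : 𝓞 K) ∉ v.asIdeal := fun ℓ h v hv hmem ↦
    hv (by rw [pl_eq ℓ h, (mem_iff ℓ h v).mp hmem])
  -- the hypotheses of §A
  have mem_selA_iff : ∀ s, s ∈ selmerGroup (A.baseChange K) p ↔ ∀ v, s ∈ LocA v := fun s ↦ by
    rw [mem_selmerGroup_iff, Sum.forall]; rfl
  have y_ne : kummerClassOfPoint B K hp Y ≠ 0 := kummerClassOfPoint_ne_zero B K hp hY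
  have cA_mem_loc : ∀ ℓ, Kol ℓ → ∀ v, v ≠ pl ℓ → cA ℓ ∈ LocA v := by
    intro ℓ h v hv
    rcases v with v | x
    · exact (hcA ℓ h).1 v (not_mem_of_ne ℓ h v hv)
    · exact (hcA ℓ h).2.1 x
  have cA_mem_loc_iff : ∀ ℓ, Kol ℓ →
      (cA ℓ ∈ LocA (pl ℓ) ↔ kummerClassOfPoint B K hp Y ∈ AB ℓ) := by
    intro ℓ h
    rw [pl_eq ℓ h, memAB ℓ h]
    exact (hcA ℓ h).2.2 _ (mem_place ℓ h)
  have cB_mem_loc : ∀ ℓ ℓ', Kol ℓ → Kol ℓ' → ℓ ≠ ℓ' → ∀ v, v ≠ pl ℓ → v ≠ pl ℓ' →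
      cB (ℓ * ℓ') ∈ LocB v := by
    intro ℓ ℓ' h h' hne v hv hv'
    rcases v with v | x
    · exact (hcB ℓ ℓ' h h' hne).1 v (not_mem_of_ne ℓ h v hv) (not_mem_of_ne ℓ' h' v hv')
    · exact (hcB ℓ ℓ' h h' hne).2.1 x
  have cB_mem_loc_iff : ∀ ℓ ℓ', Kol ℓ → Kol ℓ' → ℓ ≠ ℓ' →
      (cB (ℓ * ℓ') ∈ LocB (pl ℓ) ↔ cA ℓ' ∈ AA ℓ) := by
    intro ℓ ℓ' h h' hne
    rw [pl_eq ℓ h, memAA ℓ h]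
    exact (hcB ℓ ℓ' h h' hne).2.2 _ (mem_place ℓ h)
  have dualA : ∀ ℓ, Kol ℓ → ∀ d : galH1Torsion (A.baseChange K) p,
      (∀ v, v ≠ pl ℓ → d ∈ LocA v) → d ∉ LocA (pl ℓ) →
      ∀ s ∈ selmerGroup (A.baseChange K) p, s ∈ AA ℓ := by
    intro ℓ h d hoff hat s hs
    rw [memAA ℓ h]
    rw [pl_eq ℓ h] at hat
    refine hL2A ℓ h d (fun v hv ↦ hoff (Sum.inl v) fun hv' ↦ hv ?_) (fun x ↦ hoff (Sum.inr x)
      (by rw [pl_eq ℓ h]; simp)) _ (mem_place ℓ h) hat s hs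
    rw [pl_eq ℓ h, Sum.inl.injEq] at hv'
    rw [hv']
    exact mem_place ℓ h
  have dualB : ∀ ℓ, Kol ℓ → ∀ d : galH1Torsion (B.baseChange K) p,
      (∀ v, v ≠ pl ℓ → d ∈ LocB v) → d ∉ LocB (pl ℓ) →
      ∀ s ∈ selmerGroup (B.baseChange K) p, s ∈ AB ℓ := by
    intro ℓ h d hoff hat s hs
    rw [memAB ℓ h]
    rw [pl_eq ℓ h] at hat
    refine hL2B ℓ h d (fun v hv ↦ hoff (Sum.inl v) fun hv' ↦ hv ?_) (fun x ↦ hoff (Sum.inr x)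
      (by rw [pl_eq ℓ h]; simp)) _ (mem_place ℓ h) hat s hs
    rw [pl_eq ℓ h, Sum.inl.injEq] at hv'
    rw [hv']
    exact mem_place ℓ h
  have ceb_ne : ∀ (s : galH1Torsion (A.baseChange K) p) (t : galH1Torsion (B.baseChange K) p)
      (b : ℕ), ∃ ℓ, b < ℓ ∧ Kol ℓ ∧ (s ≠ 0 → s ∉ AA ℓ) ∧
      (t ≠ 0 → t ∉ AB ℓ) := by
    intro s t b
    obtain ⟨ℓ, ⟨hℓ, hloc⟩, hlt⟩ := (hL3a s t).exists_gt b
    refine ⟨ℓ, hlt, hℓ, fun hs ↦ ?_, fun ht ↦ ?_⟩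
    · rw [memAA ℓ hℓ]
      exact (hloc _ (mem_place ℓ hℓ)).1 hs
    · rw [memAB ℓ hℓ]
      exact (hloc _ (mem_place ℓ hℓ)).2 ht
  have ceb_line : ∀ s ∈ selmerGroup (B.baseChange K) p,
      (¬ ∃ a b : ℤ, s = a • kummerClassOfPoint B K hp Y + b • w (kummerClassOfPoint B K hp Y)) →
      ∀ c : galH1Torsion (A.baseChange K) p, c ≠ 0 → ∀ b : ℕ, ∃ ℓ, b < ℓ ∧ Kol ℓ ∧
        kummerClassOfPoint B K hp Y ∈ AB ℓ ∧ s ∉ AB ℓ ∧ c ∉ AA ℓ := by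
    intro s hs hns c hc b
    obtain ⟨ℓ, ⟨hℓ, hloc⟩, hlt⟩ := (hL3b s hs hns c hc).exists_gt b
    refine ⟨ℓ, hlt, hℓ, ?_, ?_, ?_⟩
    · rw [memAB ℓ hℓ]
      exact (hloc _ (mem_place ℓ hℓ)).1
    · rw [memAB ℓ hℓ]
      exact (hloc _ (mem_place ℓ hℓ)).2.1
    · rw [memAA ℓ hℓ]
      exact (hloc _ (mem_place ℓ hℓ)).2.2
  exact ⟨selA_eq_bot y_ne cA_mem_loc cA_mem_loc_iff dualA ceb_ne,
    selB_le_closure mem_selA_iff y_ne cA_mem_loc cA_mem_loc_iff cB_mem_loc cB_mem_loc_iff dualA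
      dualB ceb_ne ceb_line⟩

end Instantiation

end Summit.BirchSwinnertonDyer.BirchSwinnertonDyer.Theorems.SylvesterTwoCoupledDescentAtTwo

end
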